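/-
Copyright (c) 2026. Released under the Apache 2.0 license.
-/
import Mathlib

/-!
# `Balaban1983to89.B12Interfaces` — three by-number citations of B12 into [10] = B5, [13] = B9,
[14] = B8 whose unprinted seams are pure algebra, kernel-checked

T. Bałaban, *Renormalization group approach to lattice gauge field theories. I. Generation of
effective actions in a small field approximation and a coupling constant renormalization in four
dimensions*, Commun. Math. Phys. **109**, 249–301 (1987) [Balaban1987RG1] (cell paper B12; held
`paper:balaban1987-cmp109-rg-i-small-field`, journal page = PDF page + 248); its references
[10] = [Balaban1984PropagatorsI] (B5, CMP **95**, 17–40, journal page = PDF + 16), [13] =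
[Balaban1985BackgroundPropagators] (B9, CMP **99**, 389–434, PDF + 388), [14] =
[Balaban1985RegularSpaces] (B8, CMP **99**, 75–102, PDF + 74).  Companion prose: the B12-side
consumer interface ledger `HOME/b2b-balaban-b12-g4/INTERFACES-B12.md` (rows IF-B12-…; cell
GAPS rows C-b12g4-… / G-b12g4-…).  Sibling of `…Balaban1983to89.B12`, `…B5`, `…B8`, `…B9`
(all UNTOUCHED and not imported: nothing here depends on their carriers).

CITATION HEADER (lean-in-tree rule 2026-08-18).  This module KERNEL-CHECKS three ELEMENTARY,
UNPRINTED seams sitting at located by-number citations of B12 — each a few lines of linear algebra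
or arithmetic that the paper leaves to the reader behind a "see (…) [n]" or a "hence".  NOTHING
analytic of B5/B8/B9/B12 is modelled or asserted: every lemma is stated over abstract modules over
a commutative ring, or over ℝ, and the DICTIONARY to the papers' objects is recorded in the
docstrings (quotations transcribed from the ×2 renders `b2b-balaban-ref1/pages/1987-cmp109-rg-I-
small-field/…`, `…/1984-cmp95-propagators-rt-I/…`, `…/1985-cmp99-background-propagators/…`,
`…/1985-cmp99-regular-spaces-gauge-fixing/…`, checked against the OCR layers).  Value = located
edges with their algebra certified, NOT summit progress.

## Seam 1 — B12 (4.40) p. 291 ← B5 (1.65)–(1.66) p. 29: at U = 1 the quadratic form Δ_j does not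
depend on which averaging operation is used (the U = 1 instance of the cell's objection G3)

B12 p. 291 [PDF 43], verbatim: *"β_j⟨∂^ξH_j, ∂^ξH_j⟩ = β_jΔ_j, where Δ_j is given by the explicit
formula (1.66) [10]"*, and (4.41): *"Δ_{j,μν}(p′) = Δ₀(p′)δ_{μν} − ∂̄¹_μ(p′)∂¹_ν(p′) + (terms of
higher order in p′), see (1.29)–(1.37) [10]"*.  In [10] = B5 the operator Δ_k belongs to the
STRAIGHT-CONTOUR average in the axial gauge, p. 19 [PDF 3]: *"(QA)_c = Σ_{x∈B(c₋)} L^{−(d+1)}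
A([x, x(c)])"* (1.11); H_k is *"equal to a configuration A on T minimizing the form ½⟨∂A, ∂A⟩
under the conditions Q_kA = B, R∂*A = 0"* (p. 27 [PDF 11], before (1.48)), *"⟨B, Δ_kB⟩ =
⟨∂H_kB, ∂H_kB⟩"* ((1.65) p. 29 [PDF 13]); the gauge condition is reached inside {Q′_kλ = 0} by
(1.46) p. 27; under a gauge transformation λ the average moves as *"= B_c − L^{−1}((Q′λ)(c₊) −
(Q′λ)(c₋)) = B_c − (∂′Q′λ)(c)"* ((1.13) p. 19), i.e. *"Q_k∂ = ∂₁Q′_k, ∂₁ is the unit lattice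
differentiation"* ((1.55) p. 28), and *"The form ⟨B, Δ₁B⟩ is gauge invariant"* (p. 19 before
(1.15)); p. 19 also introduces the contour average (1.8) *"B_c = Σ_{x∈B(c₋)} L^{−(d+1)}
(A(Γ_{c₋,x}) + A([x, x(c)]) + A(Γ_{x(c),c₊}))"* and says *"In the future we will use both
points of view."*  B12's H_j is instead built on the EUCLIDEAN-SYMMETRIZED average, p. 253
[PDF 5] (0.4) with the contour variables (0.11) U(y, x) = the group mean over the set G(y, x) of
shortest contours from y to x, whose linearisation (0.8) is the arithmetic mean.  Linearising
(0.4) at U = 1 and using A(x′, y′) = −A(y′, x′) together with the bijection x ↦ x′ = x + L^?e_μ of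
the blocks B(c₋) → B(c₊) gives (up to the common normalisation of (1.11))
  (Q^{sym}A)(c) = (Q^{str}A)(c) − [φ_A(c₊) − φ_A(c₋)] = (Q^{str}A)(c) − (∂₁φ_A)(c),
  φ_A(y) := L^{−d} Σ_{x∈B(y)} |G(y, x)|^{−1} Σ_{Γ∈G(y,x)} A(Γ),
and for a pure gauge A = ∂λ every contour from y to x carries λ(x) − λ(y), so φ_{∂λ} = Q′λ − Sλ,
(Sλ)(y) := λ(y) (restriction to block centres); the B7-type average (1.8) has the same shape with
|G| = 1.  These are the three identities of the structure `GaugeShift` below (with `d` = ∂ acting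
on scalars λ, `δ` = ∂₁, `Q₁` = Q^{str}, `Q₂` = Q^{sym}, `Q'` = the block mean of scalars, `S`);
`GaugeShift.constraintValues_eq` is the seam — for ANY gauge-invariant functional N (here
N(A) = ‖∂A‖²) and every B the value sets {N(A) : Q^{str}A = B} and {N(A) : Q^{sym}A = B}
COINCIDE, hence so do their infima (`GaugeShift.constraintInf_eq`), i.e. the quadratic forms
B ↦ inf{‖∂A‖² : QA = B} of the two averages are the same form ⟨B, Δ₁B⟩; `GaugeShift.comp` shows
that the three identities reproduce under composition of averaging steps (B5's k-fold averages
Q_k = Q∘…∘Q, (1.19) p. 20, and B12's Ū^k), so the same holds for Δ_k at every level.  NOT proved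
here (and not claimed): that B12's H_j(B) at U = 1 is a constrained minimizer for its own average
(B12 takes H_k from [15] = B11, Thm 1 / Sect. C — the variational problem written there for the
averages of [12] = B7: objection G3 of the cell, which this seam settles only at U = 1 and only for
the quadratic form), and nothing about the explicit formula (1.66) or the expansion (4.41).

## Seam 2 — B12 (2.7) p. 266 ← B9 (3.127)–(3.129) p. 421: the cross term vanishes

B12 p. 266 [PDF 18], verbatim: *"The term with C^{(2)} together with the next term on the
right-hand side of (2.6) yield the expression
  ½⟨H₁B′ + 𝐀₁, Δ₁(H₁B′ + 𝐀₁)⟩ = ½⟨H₁B′, Δ₁H₁B′⟩ + ½⟨𝐀₁, Δ₁𝐀₁⟩,   (2.7)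
see the definitions (3.127), (3.128) [13]."*  In [13] = B9, p. 421 [PDF 33]: *"Let us denote the
operator defined by the problem (3.127), (3.110) by H₁ and by G₁ the operator defined by the
quadratic form ⟨A, G₁^{−1}A⟩ = … + ‖RD*A‖² + a‖QA‖². (3.128)  Then we have the formula H₁B =
G₁Q*(QG₁Q*)^{−1}B. (3.129)"*, the problem being solved *"in exactly the same way as the problem
(3.109), (3.110)"*, i.e. (p. 420 [PDF 32]) *"We take the Lagrange function h(A, ω) = ½⟨A, G^{−1}A⟩
− ⟨ω, QA − B⟩, and we get the following equations for the minimum ∂h/∂A = G^{−1}A − Q*ω = 0,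
∂h/∂ω = QA − B = 0, hence A = GQ*ω, QGQ*ω = B, ω = (QGQ*)^{−1}B, and finally A =
GQ*(QGQ*)^{−1}B."*  So Δ₁H₁B′ = Q*ω, and (2.7) is the statement that a critical point h of a
symmetric quadratic form on the affine space {QA = B′} is form-orthogonal to the direction space
ker Q, whence the form splits on h + a, a ∈ ker Q: `orthogonal_of_lagrange` +
`quadForm_add_of_orthogonal` (and `orthogonal_of_isMin`: the same orthogonality from minimality
instead of the multiplier, the reading "minimizing" of B5 p. 27 / B9 p. 420).  The remaining
hypothesis Q𝐀₁ = 0 on 𝐀₁ = 𝐀_{1,k} of (2.6) is B12's import from [15] = B11 (171)–(174) (cell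
rows G-IF-05…07 of `b2b-balaban-b11/INTERFACES.md`), not from [13].

## Seam 3 — B12 p. 273 ← B8 (1.3)–(1.6) p. 77: "hence □̃⁴ ⊂ □_{k+1}"

B12 p. 273 [PDF 25], verbatim: *"Thus we construct a sequence of cubes {□_n}, n = 0, 1, …, k+1,
satisfying the conditions (1.3)–(1.6) [14] (with k+1, L^{−1}η instead of k, η, R = R₁), hence
□̃⁴ ⊂ □_{k+1}."*  Here □₀ = □̃⁵ and □̃ⁿ is the cube □ (a union of 2^d cubes of the partition π_k of
the unit lattice into M-cubes, p. 270) enlarged n times by M (p. 271: *"In the first case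
dist(X, □) ≥ M, the distance is in the scale η"*).  [14] = B8 (1.4) p. 77 [PDF 3] requires Ω_j to
be a union of cubes of side M₁L^jη of the j-th partition with *"(L^jη)^{−1}dist(Ω_j^c, Ω_{j+1}) >
RM₁"* (*"M₁ … depends on d and L only"*).  With the finest spacing η′ = L^{−1}η and L^{k+1}η′ =
L^kη = 1, passing from □_n to the largest admissible □_{n+1} costs per face a collar of width at
most R₁M₁L^nη′ plus one cube of the (n+1)-st partition, M₁L^{n+1}η′, i.e. at most c·L^n/L^{k+1}
with c = (R₁ + L)M₁, n = 0, …, k; the total is < c/(L − 1) (`collar_sum_lt`), so "hence □̃⁴ ⊂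
□_{k+1}" holds as soon as M ≥ (R₁ + L)M₁/(L − 1) (`collar_fits`) — an unlisted but harmless
largeness restriction on M in terms of the d, L-constants R₁, M₁ of [14] (B12 takes M large
anyway, pp. 270, 276), recorded as cell row G-b12g4-3; grid alignment (M a multiple of M₁) is the
only other implicit requirement.
-/

namespace Literature.MathematicalPhysics.QuantumFieldTheory.Balaban1983to89.B12Interfaces

/-! ## Seam 2: critical point of a symmetric quadratic form on an affine subspace ⇒ (2.7) -/

section Pythagoras

variable {R : Type*} [CommRing R] {M N : Type*} [AddCommGroup M] [Module R M]
  [AddCommGroup N] [Module R N]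

/-- The polarised split behind B12 (2.7) p. 266: if the bilinear form `β` (think ⟨·, Δ₁ ·⟩, B9
(3.127)/(3.128)) is symmetric and `h` (think H₁B′) is `β`-orthogonal to every `a ∈ K` (think
K = ker Q, the directions of the constraint hyperplane {QA = B′}), then for `a ∈ K`
β(h + a, h + a) = β(h, h) + β(a, a).  Pure algebra over any commutative ring.
[cite: Balaban1987RG1, (2.7) p.266; Balaban1985BackgroundPropagators, (3.127)–(3.129) p.421] -/
theorem quadForm_add_of_orthogonal (β : M →ₗ[R] M →ₗ[R] R) (hsymm : ∀ x y, β x y = β y x)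
    (K : Submodule R M) (h : M) (horth : ∀ a ∈ K, β a h = 0) {a : M} (ha : a ∈ K) :
    β (h + a) (h + a) = β h h + β a a := by
  have h1 : β a h = 0 := horth a ha
  have h2 : β h a = 0 := by rw [hsymm]; exact h1
  simp only [map_add, LinearMap.add_apply, h1, h2, add_zero, zero_add]

/-- The Lagrange-multiplier form of the definition of H₁ (B9 p. 420 [PDF 32]: *"∂h/∂A = G^{−1}A −
Q*ω = 0"*, repeated for (3.127) on p. 421): if ⟨a, Δ₁h⟩ = ⟨Qa, ω⟩ for all `a` (i.e. Δ₁h = Q*ω),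
then `h` is form-orthogonal to ker Q.  (`β a h` = ⟨a, Δ₁h⟩, `pair` = the pairing on the
unit-lattice fields in which Q* is the adjoint.)
[cite: Balaban1985BackgroundPropagators, (3.121)–(3.129) pp.420–421] -/
theorem orthogonal_of_lagrange (β : M →ₗ[R] M →ₗ[R] R) (Q : M →ₗ[R] N)
    (pair : N →ₗ[R] N →ₗ[R] R) (h : M) (ω : N) (hlag : ∀ a, β a h = pair (Q a) ω) :
    ∀ a ∈ LinearMap.ker Q, β a h = 0 := by
  intro a ha
  rw [hlag, LinearMap.mem_ker.mp ha, map_zero, LinearMap.zero_apply]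

/-- (2.7) assembled from the two lemmas above: Δ₁H₁B′ = Q*ω and Q𝐀₁ = 0 give the split.
[cite: Balaban1987RG1, (2.7) p.266] -/
theorem eq27_of_lagrange (β : M →ₗ[R] M →ₗ[R] R) (hsymm : ∀ x y, β x y = β y x)
    (Q : M →ₗ[R] N) (pair : N →ₗ[R] N →ₗ[R] R) (h : M) (ω : N)
    (hlag : ∀ a, β a h = pair (Q a) ω) {a : M} (ha : Q a = 0) :
    β (h + a) (h + a) = β h h + β a a :=
  quadForm_add_of_orthogonal β hsymm (LinearMap.ker Q) h (orthogonal_of_lagrange β Q pair h ω hlag)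
    (LinearMap.mem_ker.mpr ha)

end Pythagoras

section Minimum

variable {M : Type*} [AddCommGroup M] [Module ℝ M]

/-- If `2tc + t²d ≥ 0` for every real `t`, then `c = 0` (the first variation vanishes; elementary
calculus, used for `orthogonal_of_isMin`). [folklore] -/
theorem linear_coeff_eq_zero_of_forall_nonneg (c d : ℝ) (h : ∀ t : ℝ, 0 ≤ 2 * t * c + t ^ 2 * d) :
    c = 0 := by
  by_contra hc
  have hc2 : 0 < c ^ 2 := lt_of_le_of_ne (sq_nonneg c) (Ne.symm (pow_ne_zero 2 hc))
  have hD : 0 < |d| + 1 := by positivity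
  have hdD : d - 2 * (|d| + 1) < 0 := by linarith [le_abs_self d, abs_nonneg d]
  have key := h (-c / (|d| + 1))
  have hrw : 2 * (-c / (|d| + 1)) * c + (-c / (|d| + 1)) ^ 2 * d
      = c ^ 2 / (|d| + 1) ^ 2 * (d - 2 * (|d| + 1)) := by
    field_simp
    ring
  rw [hrw] at key
  have hneg : c ^ 2 / (|d| + 1) ^ 2 * (d - 2 * (|d| + 1)) < 0 :=
    mul_neg_of_pos_of_neg (by positivity) hdD
  linarith

/-- The "minimizing" reading (B5 p. 27 [PDF 11]: H_kB is *"a configuration A on T minimizing the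
form ½⟨∂A, ∂A⟩ under the conditions Q_kA = B, R∂*A = 0"*; B9 p. 420: *"we have to find a minimum
of the functional"*): a minimizer `h` of the symmetric quadratic form A ↦ β(A, A) on the affine
space h + K is form-orthogonal to K.  Over ℝ.
[cite: Balaban1984PropagatorsI, p.27 before (1.48); Balaban1985BackgroundPropagators, (3.122) p.420] -/
theorem orthogonal_of_isMin (β : M →ₗ[ℝ] M →ₗ[ℝ] ℝ) (hsymm : ∀ x y, β x y = β y x)
    (K : Submodule ℝ M) (h : M) (hmin : ∀ a ∈ K, β h h ≤ β (h + a) (h + a)) :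
    ∀ a ∈ K, β a h = 0 := by
  intro a ha
  apply linear_coeff_eq_zero_of_forall_nonneg (β a h) (β a a)
  intro t
  have hle := hmin (t • a) (K.smul_mem t ha)
  have hexp : β (h + t • a) (h + t • a) = β h h + (2 * t * β a h + t ^ 2 * β a a) := by
    simp only [map_add, map_smul, LinearMap.add_apply, LinearMap.smul_apply, smul_eq_mul,
      hsymm h a]
    ring
  linarith [hexp ▸ hle]

end Minimum

/-! ## Seam 1: two linearised averages differing by a coarse gradient of a block functional have
the same constrained values of any gauge-invariant functional -/

section GaugeShift

variable {R : Type*} [CommRing R]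
variable {A Λ₀ Λ₁ B₁ : Type*} [AddCommGroup A] [Module R A] [AddCommGroup Λ₀] [Module R Λ₀]
  [AddCommGroup Λ₁] [Module R Λ₁] [AddCommGroup B₁] [Module R B₁]

/-- The three lattice identities relating two linearised averaging operators `Q₁`, `Q₂ : A → B₁`
(fine vector fields → coarse vector fields) in the presence of the linearised gauge action
`a ↦ a + d l` (`d : Λ₀ → A`, fine scalars → fine vector fields, the lattice gradient ∂):
* `shift`: Q₂ = Q₁ − δ ∘ φ for a block functional `φ : A → Λ₁` (coarse scalars) and the coarse
  gradient `δ : Λ₁ → B₁` — B12 (0.4)/(0.8)/(0.11) linearised against B5 (1.11), see the module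
  docstring;
* `avg_gauge`: Q₁ ∘ ∂ = ∂₁ ∘ Q′ — B5 (1.13) p. 19 / *"Q_k∂ = ∂₁Q′_k"* (1.55) p. 28, `Q'` the block
  mean of scalars;
* `phi_gauge`: φ(∂λ) = Q′λ − Sλ, `S` = restriction of scalars to block centres (every contour from
  the centre y to x carries λ(x) − λ(y));
* `Q'` and `S` are onto (constant extension on blocks is a right inverse of both).
[cite: Balaban1984PropagatorsI, (1.8), (1.11), (1.13) p.19, (1.55) p.28; Balaban1987RG1, (0.4), (0.8), (0.11) pp.253–254] -/
structure GaugeShift (d : Λ₀ →ₗ[R] A) (Q₁ Q₂ : A →ₗ[R] B₁) (δ : Λ₁ →ₗ[R] B₁)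
    (Q' S : Λ₀ →ₗ[R] Λ₁) (φ : A →ₗ[R] Λ₁) : Prop where
  shift : ∀ a, Q₂ a = Q₁ a - δ (φ a)
  avg_gauge : ∀ l, Q₁ (d l) = δ (Q' l)
  phi_gauge : ∀ l, φ (d l) = Q' l - S l
  surjQ' : Function.Surjective Q'
  surjS : Function.Surjective S

variable {d : Λ₀ →ₗ[R] A} {Q₁ Q₂ : A →ₗ[R] B₁} {δ : Λ₁ →ₗ[R] B₁} {Q' S : Λ₀ →ₗ[R] Λ₁}
  {φ : A →ₗ[R] Λ₁}

/-- THE SEAM behind B12 (4.40) ← B5 (1.65): for any gauge-invariant functional `N` on fine fields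
(B5 p. 19: *"The form ⟨B, Δ₁B⟩ is gauge invariant"*; here N = ‖∂A‖², or anything invariant under
a ↦ a + ∂λ) and every coarse field `b`, the sets of values of `N` on the two constraint
hyperplanes {Q₁a = b} and {Q₂a = b} coincide.  Proof: shift a representative by the pure gauge
∂l with Sl = φ(a), resp. Q′l = −φ(a).
[cite: Balaban1987RG1, (4.40) p.291; Balaban1984PropagatorsI, (1.65)–(1.66) p.29] -/
theorem GaugeShift.constraintValues_eq (hG : GaugeShift d Q₁ Q₂ δ Q' S φ) {X : Type*}
    (N : A → X) (hN : ∀ a l, N (a + d l) = N a) (b : B₁) :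
    {r | ∃ a, Q₁ a = b ∧ N a = r} = {r | ∃ a, Q₂ a = b ∧ N a = r} := by
  ext r
  constructor
  · rintro ⟨a, hQ, hNa⟩
    obtain ⟨l, hl⟩ := hG.surjS (φ a)
    refine ⟨a + d l, ?_, by rw [hN]; exact hNa⟩
    rw [hG.shift, map_add, map_add, hG.avg_gauge, hG.phi_gauge, hl, hQ, map_add, map_sub]
    abel
  · rintro ⟨a, hQ, hNa⟩
    obtain ⟨l, hl⟩ := hG.surjQ' (-φ a)
    refine ⟨a + d l, ?_, by rw [hN]; exact hNa⟩
    rw [hG.shift] at hQ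
    rw [map_add, hG.avg_gauge, hl, map_neg, ← hQ]
    abel

/-- Corollary for real-valued `N` (the case N(A) = ‖∂A‖² = 2 × the linearised Wilson action): the
constrained infima — the quadratic forms b ↦ inf{N(a) : Q a = b}, i.e. ⟨b, Δ₁b⟩ of B5 (1.65) for
the respective average — are equal, and one is attained iff the other is.
[cite: Balaban1984PropagatorsI, (1.65) p.29; Balaban1987RG1, (4.40) p.291] -/
theorem GaugeShift.constraintInf_eq (hG : GaugeShift d Q₁ Q₂ δ Q' S φ) (N : A → ℝ)
    (hN : ∀ a l, N (a + d l) = N a) (b : B₁) :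
    sInf {r | ∃ a, Q₁ a = b ∧ N a = r} = sInf {r | ∃ a, Q₂ a = b ∧ N a = r} := by
  rw [hG.constraintValues_eq N hN b]

/-- The minimum is attained for one average iff for the other (same witness up to a gauge shift).
[cite: Balaban1984PropagatorsI, (1.65) p.29; Balaban1987RG1, (4.40) p.291] -/
theorem GaugeShift.isLeast_iff (hG : GaugeShift d Q₁ Q₂ δ Q' S φ) (N : A → ℝ)
    (hN : ∀ a l, N (a + d l) = N a) (b : B₁) (m : ℝ) :
    IsLeast {r | ∃ a, Q₁ a = b ∧ N a = r} m ↔ IsLeast {r | ∃ a, Q₂ a = b ∧ N a = r} m := by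
  rw [hG.constraintValues_eq N hN b]

variable {Λ₂ B₂ : Type*} [AddCommGroup Λ₂] [Module R Λ₂] [AddCommGroup B₂] [Module R B₂]
  {P₁ P₂ : B₁ →ₗ[R] B₂} {δ₂ : Λ₂ →ₗ[R] B₂} {Q'₂ S₂ : Λ₁ →ₗ[R] Λ₂} {φ₂ : B₁ →ₗ[R] Λ₂}

/-- The three identities reproduce under COMPOSITION of averaging steps (the next step acts on the
coarse fields `B₁`, its gauge group being the coarse scalars `Λ₁` acting through `δ`): the k-fold
averages Q_k = Q∘…∘Q of B5 (1.19) p. 20 / the iterated B12 averages Ū^k again differ by a coarse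
gradient of a block functional, namely φ₁₂ = φ₂∘Q₁ + S₂∘φ, with Q′ ↦ Q′₂∘Q′ and S ↦ S₂∘S.  Hence
`constraintValues_eq` applies at every level k.
[cite: Balaban1984PropagatorsI, (1.19) p.20, (1.55) p.28; Balaban1987RG1, (0.4) p.253] -/
theorem GaugeShift.comp (h₁ : GaugeShift d Q₁ Q₂ δ Q' S φ) (h₂ : GaugeShift δ P₁ P₂ δ₂ Q'₂ S₂ φ₂) :
    GaugeShift d (P₁ ∘ₗ Q₁) (P₂ ∘ₗ Q₂) δ₂ (Q'₂ ∘ₗ Q') (S₂ ∘ₗ S) (φ₂ ∘ₗ Q₁ + S₂ ∘ₗ φ) where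
  shift a := by
    simp only [LinearMap.comp_apply, LinearMap.add_apply]
    rw [h₁.shift, map_sub, h₂.shift, h₂.shift, h₂.avg_gauge, h₂.phi_gauge, map_sub, map_add]
    abel
  avg_gauge l := by
    simp only [LinearMap.comp_apply]
    rw [h₁.avg_gauge, h₂.avg_gauge]
  phi_gauge l := by
    simp only [LinearMap.comp_apply, LinearMap.add_apply]
    rw [h₁.avg_gauge, h₂.phi_gauge, h₁.phi_gauge, map_sub]
    abel
  surjQ' := by
    simpa only [LinearMap.coe_comp] using h₂.surjQ'.comp h₁.surjQ'
  surjS := by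
    simpa only [LinearMap.coe_comp] using h₂.surjS.comp h₁.surjS

end GaugeShift

/-! ## Seam 3: the nested-collar sum behind "hence □̃⁴ ⊂ □_{k+1}" (B12 p. 273 ← B8 (1.4)) -/

section Collar

open Finset

/-- Σ_{n=0}^{k} c·Lⁿ/L^{k+1} < c/(L − 1) for L > 1, c > 0: the total width of the k+1 nested
collars of B8 (1.4) (width ≤ c·L^n·η′ at level n, c = (R₁ + L)M₁), measured on the unit lattice
L^{k+1}η′ = 1, is bounded independently of k.
[cite: Balaban1987RG1, p.273 "hence □̃⁴ ⊂ □_{k+1}"; Balaban1985RegularSpaces, (1.3)–(1.6) p.77] -/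
theorem collar_sum_lt (L c : ℝ) (hL : 1 < L) (hc : 0 < c) (k : ℕ) :
    ∑ n ∈ range (k + 1), c * L ^ n / L ^ (k + 1) < c / (L - 1) := by
  have hL0 : 0 < L := lt_trans zero_lt_one hL
  have hLk : 0 < L ^ (k + 1) := pow_pos hL0 _
  have hL1 : L - 1 ≠ 0 := sub_ne_zero.mpr hL.ne'
  have hgeom : ∑ n ∈ range (k + 1), L ^ n = (L ^ (k + 1) - 1) / (L - 1) := geom_sum_eq hL.ne' _
  have hsum : ∑ n ∈ range (k + 1), c * L ^ n / L ^ (k + 1)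
      = c / (L - 1) * (1 - 1 / L ^ (k + 1)) := by
    rw [← Finset.sum_div, ← Finset.mul_sum, hgeom]
    field_simp
  rw [hsum]
  have hpos : 0 < c / (L - 1) := div_pos hc (sub_pos.mpr hL)
  have hlt : 1 - 1 / L ^ (k + 1) < 1 := by
    have : 0 < 1 / L ^ (k + 1) := by positivity
    linarith
  calc c / (L - 1) * (1 - 1 / L ^ (k + 1)) < c / (L - 1) * 1 := mul_lt_mul_of_pos_left hlt hpos
    _ = c / (L - 1) := mul_one _

/-- "hence □̃⁴ ⊂ □_{k+1}": if the margin M between □̃⁵ = □₀ and □̃⁴ is at least c/(L − 1), the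
nested collars fit inside it, for every number k+1 of levels.  The hypothesis M ≥ c/(L − 1),
c = (R₁ + L)M₁, is the unlisted largeness restriction on M recorded as cell row G-b12g4-3.
[cite: Balaban1987RG1, p.273; Balaban1985RegularSpaces, (1.4) p.77] -/
theorem collar_fits (L c M : ℝ) (hL : 1 < L) (hc : 0 < c) (hM : c / (L - 1) ≤ M) (k : ℕ) :
    ∑ n ∈ range (k + 1), c * L ^ n / L ^ (k + 1) < M :=
  lt_of_lt_of_le (collar_sum_lt L c hL hc k) hM

end Collar

end Literature.MathematicalPhysics.QuantumFieldTheory.Balaban1983to89.B12Interfaces
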